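import Summits.Ventures.PercRepro.S1EightFiveRankTwoParts

/-!
# PercRepro — THE `(5, 3)` SPLIT AT `(8, 4)`: A COLOOP-FREE RANK-5 PART ON 8 POINTS ⊕ A SIMPLE COLOOP-FREE
RANK-3 PART ON 5 POINTS (p2, gen 28; SUBCLAIM-S1 §6.10 (xvii)(l))

The general triple incidence count: if the closure of every pair has at most `c + 2` points, the rank-`2`
triples number at most `c · C(|E|, 2) / 3` (`three_mul_ncard_rankTwoTriples_le_of_closure`). For the rank-`3` part
`N` on `5` points (coloop-free, all pairs of rank `2`): the closure of a pair has `≤ 3` points, so there are at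
most `3` rank-`2` triples and `f_N(3) ≥ 13` (the `4`-sets and the ground set all have rank `3`); `N_N(3, 1) ≤ 5`,
`N_N(3, 2) ≤ C(5, 3) = 10`. For the rank-`5` part `M` on `8` points: `f_M(5) ≤ 93` (the sets with at least `5`
points), `f_M(2) ≥ 28`, the double count `2 f_M(4) ≤ 5 f_M(5)`, Theorem N at `(5, 2)` and Theorem M at `(5, 3)`.
Then `Φ(8, 4) · #U ≤ 15.2 f_M(3) + 35.47 f_M(4) ≤ 13 f_M(2) + 23 f_M(3) + 28 f_M(4) + 16 f_M(5) ≤ #Y`.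
Nothing is claimed about any cell.

* `three_mul_ncard_rankTwoTriples_le_of_closure` — the general triple incidence count;
* `ncard_rankSet_three_ge_rank_three_five`, `ncard_setOf_subset_five_le_ncard_eight`;
* `c025_eight_four_disjointSum_five_three`.
Axioms: standard.
-/

open scoped Matroid

namespace PercRepro

namespace S1

open Set

variable {α : Type}

/-- **THE GENERAL TRIPLE INCIDENCE COUNT**: if the closure of every pair has at most `c + 2` points, then
`3 · #(rank-2 triples) ≤ c · C(|E|, 2)` — each triple contains `3` pairs, each pair lies in at most `c` triples. -/
theorem three_mul_ncard_rankTwoTriples_le_of_closure (M : Matroid α) [M.Finite]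
    (hpairs : ∀ e ∈ M.E, ∀ f ∈ M.E, e ≠ f → M.eRk {e, f} = 2) {c : ℕ}
    (hcl : ∀ x ∈ M.E, ∀ y ∈ M.E, x ≠ y → (M.closure {x, y}).ncard ≤ c + 2) :
    3 * (rankTwoTriples M).ncard ≤ c * Nat.choose M.E.ncard 2 := by
  have hTfin := rankTwoTriples_finite M
  have hQfin : (triplePairs M).Finite :=
    (M.ground_finite.finite_subsets.prod M.ground_finite.finite_subsets).subset
      (fun Q hQ => ⟨hQ.1.1, hQ.2.1.trans hQ.1.1⟩)
  have heq : triplePairs M = ⋃ T ∈ rankTwoTriples M, ({T} ×ˢ {P : Set α | P ⊆ T ∧ P.ncard = 2} : Set (Set α × Set α)) := by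
    ext ⟨T, P⟩
    simp only [triplePairs, mem_setOf_eq, mem_iUnion, mem_prod, mem_singleton_iff, exists_prop]
    constructor
    · rintro ⟨hT, hPT, hP2⟩
      exact ⟨T, hT, rfl, hPT, hP2⟩
    · rintro ⟨T', hT', rfl, hPT, hP2⟩
      exact ⟨hT', hPT, hP2⟩
  have hfib : ∀ T ∈ rankTwoTriples M, (({T} ×ˢ {P : Set α | P ⊆ T ∧ P.ncard = 2} : Set (Set α × Set α))).Finite :=
    fun T hT => (finite_singleton T).prod ((M.ground_finite.subset hT.1).finite_subsets.subset (fun _ hP => hP.1))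
  have hdisj : (rankTwoTriples M).PairwiseDisjoint
      (fun T : Set α => ({T} ×ˢ {P : Set α | P ⊆ T ∧ P.ncard = 2} : Set (Set α × Set α))) := by
    intro T _ T' _ hTT
    rw [Function.onFun, Set.disjoint_left]
    rintro ⟨C, P⟩ ⟨hC1, -⟩ ⟨hC2, -⟩
    apply hTT
    rw [mem_singleton_iff] at hC1 hC2
    rw [← hC1, ← hC2]
  have hlow : 3 * (rankTwoTriples M).ncard = (triplePairs M).ncard := by
    rw [heq, hTfin.ncard_biUnion hfib hdisj, finsum_mem_eq_finite_toFinset_sum _ hTfin]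
    rw [Finset.sum_congr rfl (g := fun _ => 3) ?_]
    · rw [Finset.sum_const, smul_eq_mul, ncard_eq_toFinset_card _ hTfin, mul_comm]
    · intro T hT
      rw [Finite.mem_toFinset] at hT
      rw [ncard_prod, ncard_singleton, one_mul, ncard_setOf_subset_ncard_eq (M.ground_finite.subset hT.1) 2,
        hT.2.1]
      rfl
  have hPfin : {P : Set α | P ⊆ M.E ∧ P.ncard = 2}.Finite :=
    M.ground_finite.finite_subsets.subset (fun _ hP => hP.1)
  have hup : triplePairs M ⊆ ⋃ P ∈ {P : Set α | P ⊆ M.E ∧ P.ncard = 2},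
      {Q ∈ triplePairs M | Q.2 = P} := by
    rintro ⟨T, P⟩ ⟨hT, hPT, hP2⟩
    rw [mem_iUnion₂]
    exact ⟨P, ⟨hPT.trans hT.1, hP2⟩, ⟨hT, hPT, hP2⟩, rfl⟩
  have hfibP : ∀ P ∈ {P : Set α | P ⊆ M.E ∧ P.ncard = 2}, {Q ∈ triplePairs M | Q.2 = P}.ncard ≤ c := by
    rintro P ⟨hPE, hP2⟩
    obtain ⟨x, y, hxy, rfl⟩ := ncard_eq_two.mp hP2
    have hx : x ∈ M.E := hPE (by simp)
    have hy : y ∈ M.E := hPE (by simp)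
    have hclxy := hcl x hx y hy hxy
    have hclE : M.closure {x, y} ⊆ M.E := M.closure_subset_ground _
    have hsubcl : ({x, y} : Set α) ⊆ M.closure {x, y} := M.subset_closure _ hPE
    have hdiff : (M.closure {x, y} \ {x, y}).ncard ≤ c := by
      rw [ncard_sdiff' hsubcl (M.ground_finite.subset hclE), hP2]
      omega
    have hsub : {Q ∈ triplePairs M | Q.2 = {x, y}} ⊆
        (fun z => (insert z {x, y}, ({x, y} : Set α))) '' (M.closure {x, y} \ {x, y}) := by
      rintro ⟨T, P⟩ ⟨⟨⟨hTE, hT3, hT2⟩, hPT, -⟩, hPxy⟩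
      have hPxy' : P = {x, y} := hPxy
      subst hPxy'
      have hTfin : T.Finite := M.ground_finite.subset hTE
      have h1 : (T \ {x, y}).ncard = 1 := by
        rw [ncard_sdiff' hPT hTfin, hT3, hP2]
      obtain ⟨z, hz⟩ := ncard_eq_one.mp h1
      have hzmem : z ∈ T \ {x, y} := by rw [hz]; exact mem_singleton z
      have hTeq : T = insert z {x, y} := by
        ext w
        constructor
        · intro hw
          by_cases hwxy : w ∈ ({x, y} : Set α)
          · exact Or.inr hwxy
          · have : w ∈ T \ {x, y} := ⟨hw, hwxy⟩
            rw [hz] at this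
            exact Or.inl this
        · rintro (rfl | hw)
          · exact hzmem.1
          · exact hPT hw
      refine ⟨z, ⟨?_, hzmem.2⟩, ?_⟩
      · rw [mem_closure_iff_eRk_insert_eq M (hTE hzmem.1) hPE, ← hTeq, hT2, hpairs x hx y hy hxy]
      · simp only [Prod.mk.injEq, and_true]
        exact hTeq.symm
    have hfin' : (M.closure {x, y} \ {x, y}).Finite := (M.ground_finite.subset hclE).subset sdiff_subset
    exact (ncard_le_ncard hsub (hfin'.image _)).trans ((ncard_image_le hfin').trans hdiff)
  have hcardP : {P : Set α | P ⊆ M.E ∧ P.ncard = 2}.ncard = Nat.choose M.E.ncard 2 :=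
    ncard_setOf_subset_ncard_eq M.ground_finite 2
  calc 3 * (rankTwoTriples M).ncard = (triplePairs M).ncard := hlow
    _ ≤ (⋃ P ∈ {P : Set α | P ⊆ M.E ∧ P.ncard = 2}, {Q ∈ triplePairs M | Q.2 = P}).ncard :=
        ncard_le_ncard hup (hPfin.biUnion (fun P _ => hQfin.subset (fun Q hQ => hQ.1)))
    _ ≤ ∑ᶠ P ∈ {P : Set α | P ⊆ M.E ∧ P.ncard = 2}, {Q ∈ triplePairs M | Q.2 = P}.ncard :=
        hPfin.ncard_biUnion_le _
    _ = ∑ P ∈ hPfin.toFinset, {Q ∈ triplePairs M | Q.2 = P}.ncard := finsum_mem_eq_finite_toFinset_sum _ hPfin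
    _ ≤ hPfin.toFinset.card • c := by
        apply Finset.sum_le_card_nsmul
        intro P hP
        rw [Finite.mem_toFinset] at hP
        exact hfibP P hP
    _ = c * Nat.choose M.E.ncard 2 := by rw [smul_eq_mul, ← ncard_eq_toFinset_card _ hPfin, hcardP, mul_comm]

/-- `f(3) ≥ 13` for a coloop-free matroid of rank `3` on `5` points with all pairs of rank `2`: the `3`-sets
that are not rank-`2` triples (at most `3` of those), the five `4`-sets and the ground set. -/
theorem ncard_rankSet_three_ge_rank_three_five (N : Matroid α) [N.Finite] (hN : N.eRank = ((3 : ℕ) : ℕ∞))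
    (hE : N.E.ncard = 5) (hcol : N.coloops = ∅) (hpairs : ∀ e ∈ N.E, ∀ f ∈ N.E, e ≠ f → N.eRk {e, f} = 2) :
    13 ≤ (rankSet N 3).ncard := by
  -- at most `3` rank-`2` triples
  have hcl : ∀ x ∈ N.E, ∀ y ∈ N.E, x ≠ y → (N.closure {x, y}).ncard ≤ 1 + 2 := by
    intro x hx y hy hxy
    have := ncard_closure_pair_le_of_coloops' N hN (by norm_num) hcol hpairs hx hy hxy
    rw [hE] at this
    omega
  have ht := three_mul_ncard_rankTwoTriples_le_of_closure N hpairs hcl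
  rw [hE, show Nat.choose 5 2 = 10 by decide] at ht
  -- the `3`-sets of rank `3`, the `4`-sets and `E`
  have hfin3 : {A : Set α | A ⊆ N.E ∧ A.ncard = 3}.Finite := N.ground_finite.finite_subsets.subset (fun _ hA => hA.1)
  have hfin4 : {A : Set α | A ⊆ N.E ∧ A.ncard = 4}.Finite := N.ground_finite.finite_subsets.subset (fun _ hA => hA.1)
  have hTsub : rankTwoTriples N ⊆ {A : Set α | A ⊆ N.E ∧ A.ncard = 3} := fun T hT => ⟨hT.1, hT.2.1⟩
  have hsub : ({A : Set α | A ⊆ N.E ∧ A.ncard = 3} \ rankTwoTriples N) ∪ {A : Set α | A ⊆ N.E ∧ A.ncard = 4} ∪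
      {N.E} ⊆ rankSet N 3 := by
    rintro A ((⟨⟨hAE, hA3⟩, hAT⟩ | ⟨hAE, hA4⟩) | hAE)
    · -- a `3`-set that is not a rank-`2` triple has rank `3`
      refine ⟨hAE, ?_⟩
      have hhi : N.eRk A ≤ 3 := by
        have := N.eRk_le_encard A
        rwa [← (N.ground_finite.subset hAE).cast_ncard_eq, hA3] at this
      have hlo := two_le_eRk_of_two_le_ncard hpairs hAE (by omega)
      obtain ⟨n, hn⟩ := ENat.ne_top_iff_exists.mp (ne_top_of_le_ne_top (by decide) hhi)
      rw [← hn] at hlo hhi ⊢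
      have hlo' : 2 ≤ n := by exact_mod_cast hlo
      have hhi' : n ≤ 3 := by exact_mod_cast hhi
      rcases Nat.lt_or_ge n 3 with h | h
      · exfalso
        apply hAT
        refine ⟨hAE, hA3, ?_⟩
        rw [← hn]
        have : n = 2 := by omega
        rw [this]; rfl
      · have : n = 3 := by omega
        rw [this]
    · -- a `4`-set has rank `3`: a rank-`k ≤ 2` set would miss at least `2` points
      refine ⟨hAE, ?_⟩
      have hhi : N.eRk A ≤ N.eRank := N.eRk_le_eRank A
      rw [hN] at hhi
      obtain ⟨n, hn⟩ := ENat.ne_top_iff_exists.mp (ne_top_of_le_ne_top (by decide) hhi)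
      rw [← hn] at hhi ⊢
      have hhi' : n ≤ 3 := by exact_mod_cast hhi
      rcases Nat.lt_or_ge n 3 with h | h
      · exfalso
        have hmiss := sub_add_one_le_ncard_ground_sdiff_of_coloops N hN hcol hAE hn.symm h
        rw [ncard_sdiff' hAE N.ground_finite, hE, hA4] at hmiss
        omega
      · have : n = 3 := by omega
        rw [this]
    · rw [mem_singleton_iff] at hAE
      subst hAE
      exact ⟨subset_rfl, by rw [N.eRk_ground, hN]⟩
  have h := ncard_le_ncard hsub (rankSet_finite N 3)
  have hdisj1 : Disjoint ({A : Set α | A ⊆ N.E ∧ A.ncard = 3} \ rankTwoTriples N) {A : Set α | A ⊆ N.E ∧ A.ncard = 4} := by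
    rw [Set.disjoint_left]
    rintro A ⟨⟨-, h3⟩, -⟩ ⟨-, h4⟩
    omega
  have hdisj2 : Disjoint (({A : Set α | A ⊆ N.E ∧ A.ncard = 3} \ rankTwoTriples N) ∪
      {A : Set α | A ⊆ N.E ∧ A.ncard = 4}) {N.E} := by
    rw [Set.disjoint_left]
    rintro A (⟨⟨-, h3⟩, -⟩ | ⟨-, h4⟩) hA <;> rw [mem_singleton_iff] at hA <;> subst hA <;> omega
  rw [ncard_union_eq hdisj2 ((hfin3.subset sdiff_subset).union hfin4) (finite_singleton _),
    ncard_union_eq hdisj1 (hfin3.subset sdiff_subset) hfin4, ncard_singleton,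
    ncard_sdiff hTsub (rankTwoTriples_finite N), ncard_setOf_subset_ncard_eq N.ground_finite 3, ncard_setOf_subset_ncard_eq N.ground_finite 4,
    hE] at h
  have h53 : Nat.choose 5 3 = 10 := by decide
  have h54 : Nat.choose 5 4 = 5 := by decide
  have hT3 : (rankTwoTriples N).ncard ≤ 3 := by omega
  have hT10 : (rankTwoTriples N).ncard ≤ Nat.choose 5 3 := by
    rw [h53]; omega
  omega

/-- On `8` points, the sets with at least `5` points number `93`. -/
theorem ncard_setOf_subset_five_le_ncard_eight {E : Set α} (hE : E.ncard = 8) (hfin : E.Finite) :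
    {A : Set α | A ⊆ E ∧ 5 ≤ A.ncard}.ncard = 93 := by
  have h2 := ncard_setOf_subset_two_le_ncard hfin
  rw [hE] at h2
  have hsplit : {A : Set α | A ⊆ E ∧ 2 ≤ A.ncard} =
      {A : Set α | A ⊆ E ∧ A.ncard = 2} ∪ {A : Set α | A ⊆ E ∧ A.ncard = 3} ∪ {A : Set α | A ⊆ E ∧ A.ncard = 4} ∪
        {A : Set α | A ⊆ E ∧ 5 ≤ A.ncard} := by
    ext A
    simp only [mem_setOf_eq, mem_union]
    constructor
    · rintro ⟨hAE, h⟩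
      rcases Nat.lt_or_ge A.ncard 3 with h3 | h3
      · exact Or.inl (Or.inl (Or.inl ⟨hAE, by omega⟩))
      rcases Nat.lt_or_ge A.ncard 4 with h4 | h4
      · exact Or.inl (Or.inl (Or.inr ⟨hAE, by omega⟩))
      rcases Nat.lt_or_ge A.ncard 5 with h5 | h5
      · exact Or.inl (Or.inr ⟨hAE, by omega⟩)
      · exact Or.inr ⟨hAE, h5⟩
    · rintro (((⟨hAE, h⟩ | ⟨hAE, h⟩) | ⟨hAE, h⟩) | ⟨hAE, h⟩) <;> exact ⟨hAE, by omega⟩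
  have hf : ∀ k : ℕ, {A : Set α | A ⊆ E ∧ A.ncard = k}.Finite := fun k =>
    hfin.finite_subsets.subset (fun _ hA => hA.1)
  have hf5 : {A : Set α | A ⊆ E ∧ 5 ≤ A.ncard}.Finite := hfin.finite_subsets.subset (fun _ hA => hA.1)
  rw [hsplit, ncard_union_eq (by rw [Set.disjoint_left]; rintro A ((⟨-, h⟩ | ⟨-, h⟩) | ⟨-, h⟩) ⟨-, h'⟩ <;> omega)
      (((hf 2).union (hf 3)).union (hf 4)) hf5,
    ncard_union_eq (by rw [Set.disjoint_left]; rintro A (⟨-, h⟩ | ⟨-, h⟩) ⟨-, h'⟩ <;> omega) ((hf 2).union (hf 3)) (hf 4),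
    ncard_union_eq (by rw [Set.disjoint_left]; rintro A ⟨-, h⟩ ⟨-, h'⟩; omega) (hf 2) (hf 3),
    ncard_setOf_subset_ncard_eq hfin 2, ncard_setOf_subset_ncard_eq hfin 3, ncard_setOf_subset_ncard_eq hfin 4,
    hE] at h2
  have c2 : Nat.choose 8 2 = 28 := by decide
  have c3 : Nat.choose 8 3 = 56 := by decide
  have c4 : Nat.choose 8 4 = 70 := by decide
  have p8 : 2 ^ 8 - 1 - 8 = 247 := by decide
  omega

/-- The arithmetic of the `(5, 3)`-split consumer at `(8, 4)`. -/
theorem consumer_arith_five_three_eight {u y P2 P3 f2 f3 f4 f5 : ℚ} (hU : u ≤ 10 * P2 + 5 * P3)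
    (h52 : 10 / 3 * P2 ≤ f3 + f4) (h53 : 5 / 4 * P3 ≤ f4) (hdc : 2 * f4 ≤ (4 + 1) * f5) (hf5 : f5 ≤ 93)
    (hf2 : 28 ≤ f2) (hY : 13 * f2 + 23 * f3 + 28 * f4 + 16 * f5 ≤ y) (hf3 : 0 ≤ f3) : 76 / 15 * u ≤ y := by
  linarith

/-- **The `(5, 3)`-split consumer at `(8, 4)`**: `M` coloop-free of rank `5` on `8` points, `N` coloop-free of
rank `3` on `5` points with all pairs of rank `2`. -/
theorem c025_eight_four_disjointSum_five_three (M N : Matroid α) [M.Finite] [N.Finite] (h : Disjoint M.E N.E)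
    (hM : M.eRank = ((5 : ℕ) : ℕ∞)) (hME : M.E.ncard = 8) (hcolM : M.coloops = ∅)
    (hpairsM : ∀ e ∈ M.E, ∀ f ∈ M.E, e ≠ f → M.eRk {e, f} = 2) (hN : N.eRank = ((3 : ℕ) : ℕ∞))
    (hNE : N.E.ncard = 5) (hcolN : N.coloops = ∅) (hpairsN : ∀ e ∈ N.E, ∀ f ∈ N.E, e ≠ f → N.eRk {e, f} = 2) :
    phiK 8 4 * ({A : Set α | A ⊆ (M.disjointSum N h).E ∧ (M.disjointSum N h).eRk A = ((8 : ℕ) : ℕ∞) ∧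
        (M.disjointSum N h).eRk ((M.disjointSum N h).E \ A) = ((4 : ℕ) : ℕ∞)}.ncard : ℚ) ≤
      ({A : Set α | A ⊆ (M.disjointSum N h).E ∧ ((4 : ℕ) : ℕ∞) < (M.disjointSum N h).eRk A ∧
        (M.disjointSum N h).eRk A < ((8 : ℕ) : ℕ∞)}.ncard : ℚ) := by
  -- the `U`-side
  have hU : {A : Set α | A ⊆ (M.disjointSum N h).E ∧ (M.disjointSum N h).eRk A = ((8 : ℕ) : ℕ∞) ∧
      (M.disjointSum N h).eRk ((M.disjointSum N h).E \ A) = ((4 : ℕ) : ℕ∞)}.ncard ≤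
      10 * (profileSet M 5 2).ncard + 5 * (profileSet M 5 3).ncard := by
    rw [disjointSum_ncard_U_eq_finsum M N h 8 4, finsum_mem_coe_finset]
    rw [Finset.sum_eq_add_of_mem (5, 2) (5, 3) (by decide) (by decide) (by decide) ?_]
    · dsimp only
      show (profileSet M 5 2).ncard * (profileSet N 3 2).ncard + (profileSet M 5 3).ncard * (profileSet N 3 1).ncard ≤ _
      have h1 := ncard_profileSet_top_one_le_of_pairs' hpairsN 3
      rw [hNE] at h1
      have h2 := ncard_profileSet_le_choose_of_ncard_eq (N := N) (a := 3) (b := 2) hNE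
      rw [show Nat.choose (3 + 2) 3 = 10 by decide] at h2
      calc (profileSet M 5 2).ncard * (profileSet N 3 2).ncard + (profileSet M 5 3).ncard * (profileSet N 3 1).ncard
          ≤ (profileSet M 5 2).ncard * 10 + (profileSet M 5 3).ncard * 5 :=
            Nat.add_le_add (Nat.mul_le_mul_left _ h2) (Nat.mul_le_mul_left _ h1)
        _ = 10 * (profileSet M 5 2).ncard + 5 * (profileSet M 5 3).ncard := by ring
    · rintro ⟨a, b⟩ hmem ⟨hne1, hne2⟩
      rw [Finset.mem_product, Finset.mem_range, Finset.mem_range] at hmem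
      dsimp only
      rcases Nat.lt_or_ge 5 a with ha | ha
      · rw [profileSet_eq_empty_of_eRank_lt M hM ha b, ncard_empty, zero_mul]
      rcases Nat.lt_or_ge a 5 with ha' | ha'
      · have h9a : 3 < 8 - a := by omega
        rw [profileSet_eq_empty_of_eRank_lt N hN h9a (4 - b), ncard_empty, mul_zero]
      have ha5 : a = 5 := by omega
      subst ha5
      rw [show (8 : ℕ) - 5 = 3 from rfl]
      rcases Nat.lt_or_ge b 2 with hb | hb
      · have h5 : N.E.ncard < 3 + (4 - b) := by rw [hNE]; omega
        rw [profileSet_eq_empty_of_ncard_lt N h5, ncard_empty, mul_zero]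
      · have hb4 : b = 4 := by
          rcases Nat.lt_or_ge b 4 with hb4 | hb4
          · exfalso
            rcases Nat.lt_or_ge b 3 with hb3 | hb3
            · exact hne1 (by congr 1; omega)
            · exact hne2 (by congr 1; omega)
          · omega
        subst hb4
        rw [profileSet_eq_empty_of_ncard_lt M (by rw [hME]; norm_num : M.E.ncard < 5 + 4), ncard_empty, zero_mul]
  -- the `Y`-side
  have hY : 13 * (rankSet M 2).ncard + 23 * (rankSet M 3).ncard + 28 * (rankSet M 4).ncard +
      16 * (rankSet M 5).ncard ≤
      {A : Set α | A ⊆ (M.disjointSum N h).E ∧ ((4 : ℕ) : ℕ∞) < (M.disjointSum N h).eRk A ∧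
        (M.disjointSum N h).eRk A < ((8 : ℕ) : ℕ∞)}.ncard := by
    rw [disjointSum_ncard_Y_eq_finsum M N h 8 4, finsum_mem_coe_finset]
    have hsub : ({(2, 3), (3, 2), (3, 3), (4, 1), (4, 2), (4, 3), (5, 0), (5, 1), (5, 2)} : Finset (ℕ × ℕ)) ⊆
        (Finset.range 8 ×ˢ Finset.range 8).filter (fun x : ℕ × ℕ => 4 < x.1 + x.2 ∧ x.1 + x.2 < 8) := by
      decide
    refine le_trans ?_ (Finset.sum_le_sum_of_subset hsub)
    rw [Finset.sum_insert (by decide), Finset.sum_insert (by decide), Finset.sum_insert (by decide),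
      Finset.sum_insert (by decide), Finset.sum_insert (by decide), Finset.sum_insert (by decide),
      Finset.sum_insert (by decide), Finset.sum_insert (by decide), Finset.sum_singleton]
    dsimp only
    have f0 : 1 ≤ (rankSet N 0).ncard := by
      have h0 : (∅ : Set α) ∈ rankSet N 0 := ⟨empty_subset _, by rw [N.eRk_empty]; rfl⟩
      exact (ncard_pos (rankSet_finite N 0)).mpr ⟨∅, h0⟩
    have f1 : 5 ≤ (rankSet N 1).ncard := by
      have := ncard_le_ncard_rankSet_one_of_pairs hpairsN (by omega)
      rwa [hNE] at this
    have f2 : 10 ≤ (rankSet N 2).ncard := by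
      have := choose_le_ncard_rankSet_two_of_pairs hpairsN
      rwa [hNE, show Nat.choose 5 2 = 10 by decide] at this
    have f3 := ncard_rankSet_three_ge_rank_three_five N hN hNE hcolN hpairsN
    have e23 := Nat.mul_le_mul_left (rankSet M 2).ncard f3
    have e32 := Nat.mul_le_mul_left (rankSet M 3).ncard f2
    have e33 := Nat.mul_le_mul_left (rankSet M 3).ncard f3
    have e41 := Nat.mul_le_mul_left (rankSet M 4).ncard f1
    have e42 := Nat.mul_le_mul_left (rankSet M 4).ncard f2
    have e43 := Nat.mul_le_mul_left (rankSet M 4).ncard f3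
    have e50 := Nat.mul_le_mul_left (rankSet M 5).ncard f0
    have e51 := Nat.mul_le_mul_left (rankSet M 5).ncard f1
    have e52 := Nat.mul_le_mul_left (rankSet M 5).ncard f2
    linarith
  -- the tree cells on `M` and the profile of `M`
  have h52 : (10 / 3 : ℚ) * ((profileSet M 5 2).ncard : ℚ) ≤
      ((rankSet M 3).ncard : ℚ) + ((rankSet M 4).ncard : ℚ) := by
    have h0 := ThmN.c025_two_all M 5 (by norm_num)
    unfold ThmN.RLS at h0
    rw [phiK_five_two, ySet_eq_rankSet_union_of_eq M (q := 2) (p := 5) (k := 3) (k' := 4) rfl rfl rfl,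
      ncard_union_eq (rankSet_disjoint_of_ne M (by norm_num)) (rankSet_finite M 3) (rankSet_finite M 4)] at h0
    push_cast at h0
    exact h0
  have h53 : (5 / 4 : ℚ) * ((profileSet M 5 3).ncard : ℚ) ≤ ((rankSet M 4).ncard : ℚ) := by
    have h0 := ThmN.RLS_of_ncard_eq M (p := 5) (q := 3) hME
    unfold ThmN.RLS at h0
    rw [ThmO.phiK_five_three, ySet_eq_rankSet_of_eq M (q := 3) (p := 5) (k := 4) rfl rfl] at h0
    exact h0
  have hdc : 2 * (rankSet M 4).ncard ≤ (4 + 1) * (rankSet M (4 + 1)).ncard :=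
    two_mul_ncard_rankSet_le M (r := 4) hM hcolM
  have hf5 : (rankSet M 5).ncard ≤ 93 := by
    have hsub : rankSet M 5 ⊆ {A : Set α | A ⊆ M.E ∧ 5 ≤ A.ncard} := by
      rintro A ⟨hAE, hA5⟩
      refine ⟨hAE, ?_⟩
      have := M.eRk_le_encard A
      rw [hA5, ← (M.ground_finite.subset hAE).cast_ncard_eq] at this
      exact_mod_cast this
    have := ncard_le_ncard hsub (M.ground_finite.finite_subsets.subset (fun _ hA => hA.1))
    rwa [ncard_setOf_subset_five_le_ncard_eight hME M.ground_finite] at this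
  have hf2 : 28 ≤ (rankSet M 2).ncard := by
    have := choose_le_ncard_rankSet_two_of_pairs hpairsM
    rwa [hME, show Nat.choose 8 2 = 28 by decide] at this
  rw [phiK_eight_four]
  have hU' : (({A : Set α | A ⊆ (M.disjointSum N h).E ∧ (M.disjointSum N h).eRk A = ((8 : ℕ) : ℕ∞) ∧
      (M.disjointSum N h).eRk ((M.disjointSum N h).E \ A) = ((4 : ℕ) : ℕ∞)}.ncard : ℕ) : ℚ) ≤
      10 * ((profileSet M 5 2).ncard : ℚ) + 5 * ((profileSet M 5 3).ncard : ℚ) := by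
    exact_mod_cast hU
  have hY' : 13 * ((rankSet M 2).ncard : ℚ) + 23 * ((rankSet M 3).ncard : ℚ) + 28 * ((rankSet M 4).ncard : ℚ) +
      16 * ((rankSet M 5).ncard : ℚ) ≤
      (({A : Set α | A ⊆ (M.disjointSum N h).E ∧ ((4 : ℕ) : ℕ∞) < (M.disjointSum N h).eRk A ∧
        (M.disjointSum N h).eRk A < ((8 : ℕ) : ℕ∞)}.ncard : ℕ) : ℚ) := by
    exact_mod_cast hY
  have hdc' : (2 : ℚ) * ((rankSet M 4).ncard : ℚ) ≤ (4 + 1) * ((rankSet M 5).ncard : ℚ) := by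
    exact_mod_cast hdc
  have hf5' : ((rankSet M 5).ncard : ℚ) ≤ 93 := by exact_mod_cast hf5
  have hf2' : (28 : ℚ) ≤ ((rankSet M 2).ncard : ℚ) := by exact_mod_cast hf2
  exact consumer_arith_five_three_eight hU' h52 h53 hdc' hf5' hf2' hY' (Nat.cast_nonneg _)

end S1

end PercRepro
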